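import Summits.CriticalPhenomena.PercolationContinuityZ3.Theorems.PercNearOneGluingNoHeavyLowerTailKNGoodThreeRelaysBorrow
import Literature.Probability.Percolation.KozmaNitzanGoodQuadruple
import HarnessLib

/-!
# `NoHeavyLowerTail` (stmt-CriticalPhenomena-4575) — THEOREM C: strong goodness / Kozma–Nitzan goodness for three relays under
# the BORROWING hypothesis (beyond Kozma–Nitzan's Theorem 2)

Support file (`--supports stmt-CriticalPhenomena-4575`, hull-port prover `prim-hp-2`, gen 25).  No new definitions, no named facts,
no sorries; standard axioms.  The wrapper from the event-level `KNGoodThreeKN.core_borrow` to the goodness functional, exactly as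
`…KNGoodThreeRelaysKNStrong.lean` wraps `KNGoodThreeKN.core` (designee classes `𝒬_a = {W : P_a(W) < P_c(W), P_a(W) ≤ P_t(W)}`,
`𝒬_t = {W : P_t(W) < P_c(W), P_t(W) < P_a(W)}`).

* `KNGoodThreeKN.strongGood_triple_borrow` — `c, a, t` relays with `P(c↔b) ≤ P(a↔b), P(t↔b)`; `β, γ ≥ 0`, `β + γ ≤ 1`,
  `β·P(a↔b, a↮t, t↔c) ≤ P(a↔b) − P(c↔b)`, `γ·P(t↔b, a↮t, a↔c) ≤ P(t↔b) − P(c↔b)`,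
  `P(c↔b, a↮b, t↮b) ≤ P(a↔b, t↔b, c↮b) + β·P(a↔b, a↮t, {a,t}↮c) + γ·P(t↔b, a↮t, {a,t}↮c)`:
  `min_x P(x↔b) − Σ_{W∩A=∅} P(C(o)=W)·min_x P_{G∖W}(x↔b) ≤ P(o↔b, o↔A)`  (`A = {c,a,t}`) — strong goodness.
* `KNGoodThreeKN.knGood_triple_borrow` — hence `KNGood w {c,a,t} _ o b`.
With `β = γ = 0` these are `strongGood_triple_of_KN` / `knGood_triple_of_KN` (Kozma–Nitzan's Thm-2 hypothesis `m_c ≤ m_{at}`);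
the new content is the region `m_c > m_{at}` ("uncovered"): prim-hp-2 MEMO-gen25 §1 (on ≈ 400 sampled instances of the uncovered
region the hypothesis holds on all generic ones and on all single ties; it fails only near double ties `P(ab) = P(tb) = P(cb)`).
[cite: KozmaNitzan2024, §3.2 Definition (p. 12), Thm. 2 (p. 8), inequalities (2)–(3) (p. 3)]
[cite: VandenbergHaggstromKahn2005, Thm. 1.1 (pp. 3–5)]
-/

noncomputable section

namespace Summit.CriticalPhenomena.PercolationContinuityZ3.Theorems

open MeasureTheory Set Literature.Probability.LatticeModels Literature.Probability.Percolation
open scoped Classical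

namespace KNGoodThreeKN

open KNGoodAux KNGoodPocketBHK

variable {V : Type*} [Fintype V]

/-- **THEOREM C — strong goodness for three relays under the borrowing hypothesis.**  For ANY finite weighted graph,
observer `o`, target `b` and relays `c, a, t` with `P(c↔b) ≤ P(a↔b)`, `P(c↔b) ≤ P(t↔b)`, and `β, γ ≥ 0`, `β + γ ≤ 1` with
`β·P(a↔b,a↮t,t↔c) ≤ P(ab)−P(cb)`, `γ·P(t↔b,a↮t,a↔c) ≤ P(tb)−P(cb)`, `m_c ≤ m_{at} + β·P(ab|c|t) + γ·P(tb|a|c)`: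
`min_x P(x↔b) − Σ_{W ∩ A = ∅} P(C(o)=W)·min_x P_{G∖W}(x↔b) ≤ P(o↔b, o↔A)`, `A = {c,a,t}`.
[cite: KozmaNitzan2024, §3.2 Definition (p. 12), Thm. 2 (p. 8)] -/
theorem strongGood_triple_borrow (w : Sym2 V → unitInterval) (o b c a t : V)
    (hca : (prodBernoulli w).real (openConn c b) ≤ (prodBernoulli w).real (openConn a b))
    (hct : (prodBernoulli w).real (openConn c b) ≤ (prodBernoulli w).real (openConn t b))
    (β γ : ℝ) (hβ0 : 0 ≤ β) (hγ0 : 0 ≤ γ) (hβγ : β + γ ≤ 1)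
    (hβ : β * (prodBernoulli w).real (openConn a b ∩ (openConn a t)ᶜ ∩ openConn t c) ≤
      (prodBernoulli w).real (openConn a b) - (prodBernoulli w).real (openConn c b))
    (hγ : γ * (prodBernoulli w).real (openConn t b ∩ (openConn a t)ᶜ ∩ openConn a c) ≤
      (prodBernoulli w).real (openConn t b) - (prodBernoulli w).real (openConn c b))
    (hX : (prodBernoulli w).real (openConn c b ∩ (openConn a b)ᶜ ∩ (openConn t b)ᶜ) ≤
      (prodBernoulli w).real (openConn a b ∩ openConn t b ∩ (openConn c b)ᶜ) +
        β * (prodBernoulli w).real (openConn a b ∩ (openConn a t)ᶜ ∩ avoidSet ({a, t} : Set V) {c}) +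
        γ * (prodBernoulli w).real (openConn t b ∩ (openConn a t)ᶜ ∩ avoidSet ({a, t} : Set V) {c})) :
    ({c, a, t} : Finset V).inf' (Finset.insert_nonempty c {a, t}) (fun x => (prodBernoulli w).real (openConn x b)) -
        ∑ W ∈ nullSets ({c, a, t} : Finset V), (prodBernoulli w).real (clusterIs o W) *
          ({c, a, t} : Finset V).inf' (Finset.insert_nonempty c {a, t})
            (fun x => (prodBernoulli w).real (openConnIn ((↑W : Set V)ᶜ) x b)) ≤
      (prodBernoulli w).real (openConn o b ∩ (openConn o c ∪ openConn o a ∪ openConn o t)) := by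
  classical
  set μ := prodBernoulli w with hμ
  haveI : IsProbabilityMeasure μ := by rw [hμ]; infer_instance
  have hmeas : ∀ S : Set (BondConfig V), MeasurableSet S := fun _ => MeasurableSet.of_discrete
  have hAne : ({c, a, t} : Finset V).Nonempty := Finset.insert_nonempty c {a, t}
  have hnull : ∀ W ∈ nullSets ({c, a, t} : Finset V), c ∉ W ∧ a ∉ W ∧ t ∉ W := by
    intro W hW
    have hd := mem_nullSets.1 hW
    exact ⟨fun h => Finset.disjoint_left.1 hd h (by simp), fun h => Finset.disjoint_left.1 hd h (by simp),
      fun h => Finset.disjoint_left.1 hd h (by simp)⟩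
  set Pc : Finset V → ℝ := fun W => μ.real (clusterIs o W ∩ openConn c b) with hPc
  set Pa : Finset V → ℝ := fun W => μ.real (clusterIs o W ∩ openConn a b) with hPa
  set Pt : Finset V → ℝ := fun W => μ.real (clusterIs o W ∩ openConn t b) with hPt
  -- Step A
  have stepA : ({c, a, t} : Finset V).inf' hAne (fun x => μ.real (openConn x b)) ≤ μ.real (openConn c b) :=
    Finset.inf'_le _ (by simp)
  -- Step B: pocket by pocket
  have stepB : ∀ W ∈ nullSets ({c, a, t} : Finset V),
      Pc W - max (max (Pc W - Pa W) (Pc W - Pt W)) 0 ≤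
        μ.real (clusterIs o W) * ({c, a, t} : Finset V).inf' hAne (fun x => μ.real (openConnIn ((↑W : Set V)ᶜ) x b)) := by
    intro W hW
    obtain ⟨hcW, haW, htW⟩ := hnull W hW
    have ec : Pc W = μ.real (clusterIs o W) * μ.real (openConnIn ((↑W : Set V)ᶜ) c b) :=
      real_clusterIs_inter_openConn w o W hcW b
    have ea : Pa W = μ.real (clusterIs o W) * μ.real (openConnIn ((↑W : Set V)ᶜ) a b) :=
      real_clusterIs_inter_openConn w o W haW b
    have et : Pt W = μ.real (clusterIs o W) * μ.real (openConnIn ((↑W : Set V)ᶜ) t b) :=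
      real_clusterIs_inter_openConn w o W htW b
    have hinf : ({c, a, t} : Finset V).inf' hAne (fun x => μ.real (openConnIn ((↑W : Set V)ᶜ) x b)) =
        μ.real (openConnIn ((↑W : Set V)ᶜ) c b) ⊓ (μ.real (openConnIn ((↑W : Set V)ᶜ) a b) ⊓
          μ.real (openConnIn ((↑W : Set V)ᶜ) t b)) := by
      rw [Finset.inf'_insert, Finset.inf'_insert, Finset.inf'_singleton]
      all_goals first | exact Finset.singleton_nonempty _ | exact Finset.insert_nonempty _ _
    rw [hinf]
    have h0 : 0 ≤ μ.real (clusterIs o W) := measureReal_nonneg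
    have hm1 := le_max_right (max (Pc W - Pa W) (Pc W - Pt W)) 0
    have hm2 : Pc W - Pa W ≤ max (max (Pc W - Pa W) (Pc W - Pt W)) 0 := (le_max_left _ _).trans (le_max_left _ _)
    have hm3 : Pc W - Pt W ≤ max (max (Pc W - Pa W) (Pc W - Pt W)) 0 := (le_max_right _ _).trans (le_max_left _ _)
    rcases le_total (μ.real (openConnIn ((↑W : Set V)ᶜ) c b))
      (μ.real (openConnIn ((↑W : Set V)ᶜ) a b) ⊓ μ.real (openConnIn ((↑W : Set V)ᶜ) t b)) with h | h
    · rw [inf_eq_left.2 h, ← ec]; linarith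
    · rw [inf_eq_right.2 h]
      rcases le_total (μ.real (openConnIn ((↑W : Set V)ᶜ) a b)) (μ.real (openConnIn ((↑W : Set V)ᶜ) t b)) with h' | h'
      · rw [inf_eq_left.2 h', ← ea]; linarith
      · rw [inf_eq_right.2 h', ← et]; linarith
  have stepB' : ∑ W ∈ nullSets ({c, a, t} : Finset V), Pc W -
      ∑ W ∈ nullSets ({c, a, t} : Finset V), max (max (Pc W - Pa W) (Pc W - Pt W)) 0 ≤
      ∑ W ∈ nullSets ({c, a, t} : Finset V), μ.real (clusterIs o W) *
        ({c, a, t} : Finset V).inf' hAne (fun x => μ.real (openConnIn ((↑W : Set V)ᶜ) x b)) := by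
    rw [← Finset.sum_sub_distrib]; exact Finset.sum_le_sum stepB
  set NA : Set (BondConfig V) := {ω | ∀ x ∈ ({c, a, t} : Finset V), ¬ (openGraph ω).Reachable o x} with hNA
  have sumPc : ∑ W ∈ nullSets ({c, a, t} : Finset V), Pc W = μ.real (NA ∩ openConn c b) :=
    sum_real_clusterIs_inter w {c, a, t} o _
  -- Step C: designee classes
  set Pka : Finset (Finset V) := (nullSets ({c, a, t} : Finset V)).filter fun W => Pa W < Pc W ∧ Pa W ≤ Pt W with hPka
  set Pkt : Finset (Finset V) := (nullSets ({c, a, t} : Finset V)).filter fun W => Pt W < Pc W ∧ Pt W < Pa W with hPkt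
  have hPkasub : Pka ⊆ nullSets ({c, a, t} : Finset V) := Finset.filter_subset _ _
  have hPktsub : Pkt ⊆ nullSets ({c, a, t} : Finset V) := Finset.filter_subset _ _
  have stepC : ∑ W ∈ nullSets ({c, a, t} : Finset V), max (max (Pc W - Pa W) (Pc W - Pt W)) 0 =
      (∑ W ∈ Pka, Pc W - ∑ W ∈ Pka, Pa W) + (∑ W ∈ Pkt, Pc W - ∑ W ∈ Pkt, Pt W) := by
    rw [← Finset.sum_sub_distrib, ← Finset.sum_sub_distrib]
    have key : ∀ W ∈ nullSets ({c, a, t} : Finset V), max (max (Pc W - Pa W) (Pc W - Pt W)) 0 =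
        (if Pa W < Pc W ∧ Pa W ≤ Pt W then Pc W - Pa W else 0) + (if Pt W < Pc W ∧ Pt W < Pa W then Pc W - Pt W else 0) := by
      intro W _
      by_cases h1 : Pa W < Pc W ∧ Pa W ≤ Pt W
      · have h2 : ¬ (Pt W < Pc W ∧ Pt W < Pa W) := fun h => absurd h1.2 (not_le.2 h.2)
        rw [if_pos h1, if_neg h2, add_zero]
        rw [max_eq_left ((le_max_left _ _).trans' (by linarith [h1.1] : (0:ℝ) ≤ Pc W - Pa W)), max_eq_left (by linarith [h1.2])]
      · rw [if_neg h1, zero_add]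
        by_cases h2 : Pt W < Pc W ∧ Pt W < Pa W
        · rw [if_pos h2]
          rw [max_eq_left ((le_max_right _ _).trans' (by linarith [h2.1] : (0:ℝ) ≤ Pc W - Pt W)), max_eq_right (by linarith [h2.2])]
        · rw [if_neg h2]
          apply max_eq_right
          rcases le_or_gt (Pa W) (Pt W) with h3 | h3
          · have h4 : Pc W ≤ Pa W := not_lt.1 (fun h => h1 ⟨h, h3⟩)
            exact max_le (by linarith) (by linarith)
          · have h4 : Pc W ≤ Pt W := not_lt.1 (fun h => h2 ⟨h, h3⟩)
            exact max_le (by linarith) (by linarith)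
    rw [Finset.sum_congr rfl key, Finset.sum_add_distrib, Finset.sum_ite, Finset.sum_ite, Finset.sum_const_zero,
      Finset.sum_const_zero, add_zero, add_zero]
  -- the pockets of each class
  set Poca : Set (BondConfig V) := ⋃ W ∈ Pka, clusterIs o W with hPoca
  set Poct : Set (BondConfig V) := ⋃ W ∈ Pkt, clusterIs o W with hPoct
  have sumP : ∀ (Pk : Finset (Finset V)) (E : Set (BondConfig V)),
      ∑ W ∈ Pk, μ.real (clusterIs o W ∩ E) = μ.real ((⋃ W ∈ Pk, clusterIs o W) ∩ E) := by
    intro Pk E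
    have hdisj : Set.PairwiseDisjoint (↑Pk : Set (Finset V)) fun W => clusterIs o W ∩ E := by
      intro W _ W' _ hne
      exact (pairwise_disjoint_clusterIs o hne).mono inter_subset_left inter_subset_left
    rw [← measureReal_biUnion_finset hdisj fun W _ => hmeas _, Set.iUnion₂_inter]
  set Qa : Set (Set V) := {S | ∃ W ∈ Pka, (↑W : Set V) = S} with hQa
  set Qt : Set (Set V) := {S | ∃ W ∈ Pkt, (↑W : Set V) = S} with hQt
  have hQa3 : ∀ S ∈ Qa, a ∉ S ∧ t ∉ S ∧ c ∉ S := by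
    rintro S ⟨W, hW, rfl⟩
    obtain ⟨hcW, haW, htW⟩ := hnull W (hPkasub hW)
    exact ⟨fun h => haW (Finset.mem_coe.1 h), fun h => htW (Finset.mem_coe.1 h), fun h => hcW (Finset.mem_coe.1 h)⟩
  have hQt3 : ∀ S ∈ Qt, a ∉ S ∧ t ∉ S ∧ c ∉ S := by
    rintro S ⟨W, hW, rfl⟩
    obtain ⟨hcW, haW, htW⟩ := hnull W (hPktsub hW)
    exact ⟨fun h => haW (Finset.mem_coe.1 h), fun h => htW (Finset.mem_coe.1 h), fun h => hcW (Finset.mem_coe.1 h)⟩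
  have hdisQ : Disjoint Qa Qt := by
    rw [Set.disjoint_left]
    rintro S ⟨W, hW, rfl⟩ ⟨W', hW', hWW'⟩
    have : W' = W := Finset.coe_injective hWW'
    subst this
    have h1 := (Finset.mem_filter.1 hW).2.2
    have h2 := (Finset.mem_filter.1 hW').2.2
    exact absurd h1 (not_le.2 h2)
  have memPoca : ∀ ω, ω ∈ Poca ↔ openCluster ω o ∈ Qa := by
    intro ω
    simp only [hPoca, hQa, Set.mem_iUnion, Set.mem_setOf_eq, mem_clusterIs, exists_prop]
    constructor
    · rintro ⟨W, hW, h⟩; exact ⟨W, hW, h.symm⟩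
    · rintro ⟨W, hW, h⟩; exact ⟨W, hW, h.symm⟩
  have memPoct : ∀ ω, ω ∈ Poct ↔ openCluster ω o ∈ Qt := by
    intro ω
    simp only [hPoct, hQt, Set.mem_iUnion, Set.mem_setOf_eq, mem_clusterIs, exists_prop]
    constructor
    · rintro ⟨W, hW, h⟩; exact ⟨W, hW, h.symm⟩
    · rintro ⟨W, hW, h⟩; exact ⟨W, hW, h.symm⟩
  have hPoca_pk : Poca = pk o Qa := by ext ω; rw [memPoca]; rfl
  have hPoct_pk : Poct = pk o Qt := by ext ω; rw [memPoct]; rfl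
  -- the event-level theorem
  have hcore := core_borrow w o b a t c Qa Qt hQa3 hQt3 hdisQ hca hct β γ hβ0 hγ0 hβγ hβ hγ hX
  rw [← hμ, ← hPoca_pk, ← hPoct_pk] at hcore
  -- pocket differences as differences on E_c / E_x
  have dif : ∀ (P : Set (BondConfig V)) (x : V),
      μ.real (P ∩ openConn c b) - μ.real (P ∩ openConn x b) =
        μ.real (P ∩ (openConn c b ∩ (openConn x b)ᶜ)) - μ.real (P ∩ (openConn x b ∩ (openConn c b)ᶜ)) := by
    intro P x
    have e1 : μ.real ((P ∩ openConn c b) ∩ openConn x b) + μ.real ((P ∩ openConn c b) \ openConn x b) =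
        μ.real (P ∩ openConn c b) := measureReal_inter_add_sdiff (hmeas _)
    have e2 : μ.real ((P ∩ openConn x b) ∩ openConn c b) + μ.real ((P ∩ openConn x b) \ openConn c b) =
        μ.real (P ∩ openConn x b) := measureReal_inter_add_sdiff (hmeas _)
    have e3 : (P ∩ openConn c b) ∩ openConn x b = (P ∩ openConn x b) ∩ openConn c b := by
      rw [Set.inter_assoc, Set.inter_assoc, Set.inter_comm (openConn c b)]
    have e4 : (P ∩ openConn c b) \ openConn x b = P ∩ (openConn c b ∩ (openConn x b)ᶜ) := by
      ext ω; simp only [Set.mem_sdiff, Set.mem_inter_iff, Set.mem_compl_iff]; tauto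
    have e5 : (P ∩ openConn x b) \ openConn c b = P ∩ (openConn x b ∩ (openConn c b)ᶜ) := by
      ext ω; simp only [Set.mem_sdiff, Set.mem_inter_iff, Set.mem_compl_iff]; tauto
    rw [e3] at e1; rw [e4] at e1; rw [e5] at e2
    linarith
  have difa := dif Poca a
  have dift := dif Poct t
  -- the designated part: `μ(c↔b ∖ NA) = μ(o↔b, o↔c) + μ(c↔b, o↮b, o↔{a,t})`
  have d0 : μ.real (openConn c b ∩ NA) + μ.real (openConn c b \ NA) = μ.real (openConn c b) :=
    measureReal_inter_add_sdiff (hmeas _)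
  set G₁ : Set (BondConfig V) := {ω | (openGraph ω).Reachable o b ∧ (openGraph ω).Reachable o c} with hG₁
  have d1 : μ.real (openConn c b \ NA) ≤
      μ.real G₁ + μ.real (openConn c b ∩ (openConn o b)ᶜ ∩ (openConn o a ∪ openConn o t)) := by
    refine (measureReal_mono (fun ω hω => ?_)).trans (measureReal_union_le G₁ _)
    obtain ⟨hcb, hNAω⟩ := hω
    simp only [hNA, Set.mem_setOf_eq, not_forall, not_not, exists_prop] at hNAω
    obtain ⟨x, hxA, hox⟩ := hNAω
    simp only [Finset.mem_insert, Finset.mem_singleton] at hxA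
    simp only [hG₁, openConn, Set.mem_union, Set.mem_inter_iff, Set.mem_compl_iff, Set.mem_setOf_eq]
    simp only [openConn, Set.mem_setOf_eq] at hcb
    by_cases hob : (openGraph ω).Reachable o b
    · exact Or.inl ⟨hob, hob.trans hcb.symm⟩
    · rcases hxA with rfl | rfl | rfl
      · exact absurd (hox.trans hcb) hob
      · exact Or.inr ⟨⟨hcb, hob⟩, Or.inl hox⟩
      · exact Or.inr ⟨⟨hcb, hob⟩, Or.inr hox⟩
  have d2 : μ.real G₁ + μ.real (openConn o b ∩ (openConn c b)ᶜ ∩ (openConn o a ∪ openConn o t)) ≤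
      μ.real (openConn o b ∩ (openConn o c ∪ openConn o a ∪ openConn o t)) := by
    have hd : Disjoint G₁ (openConn o b ∩ (openConn c b)ᶜ ∩ (openConn o a ∪ openConn o t)) := by
      rw [Set.disjoint_left]
      rintro ω ⟨hob, hoc⟩ ⟨⟨-, hcb⟩, -⟩
      exact hcb (hoc.symm.trans hob)
    rw [← measureReal_union hd (hmeas _)]
    refine measureReal_mono (fun ω hω => ?_)
    simp only [openConn, Set.mem_inter_iff, Set.mem_union, Set.mem_compl_iff, Set.mem_setOf_eq, hG₁] at hω ⊢
    rcases hω with ⟨hob, hoc⟩ | ⟨⟨hob, -⟩, hoa | hot⟩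
    · exact ⟨hob, Or.inl (Or.inl hoc)⟩
    · exact ⟨hob, Or.inl (Or.inr hoa)⟩
    · exact ⟨hob, Or.inr hot⟩
  -- assemble
  have sPca := sumP Pka (openConn c b)
  have sPaa := sumP Pka (openConn a b)
  have sPct := sumP Pkt (openConn c b)
  have sPtt := sumP Pkt (openConn t b)
  rw [Set.inter_comm] at sumPc
  have hsum := stepB'
  rw [stepC, sumPc, sPca, sPaa, sPct, sPtt] at hsum
  linarith [hsum, stepA, d0, d1, d2, hcore, difa, dift]

/-- **THEOREM C — Kozma–Nitzan goodness for three relays under the borrowing hypothesis**: with `c` the least reliable relay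
and `β, γ` as in `strongGood_triple_borrow`, the quadruple `(G, {c,a,t}, o, b)` is good — for EVERY finite weighted graph and every
observer; `β = γ = 0` is Kozma–Nitzan's Theorem-2 hypothesis. [cite: KozmaNitzan2024, §3.2 Definition (p. 12), Thm. 2 (p. 8)] -/
theorem knGood_triple_borrow (w : Sym2 V → unitInterval) (o b c a t : V)
    (hca : (prodBernoulli w).real (openConn c b) ≤ (prodBernoulli w).real (openConn a b))
    (hct : (prodBernoulli w).real (openConn c b) ≤ (prodBernoulli w).real (openConn t b))
    (β γ : ℝ) (hβ0 : 0 ≤ β) (hγ0 : 0 ≤ γ) (hβγ : β + γ ≤ 1)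
    (hβ : β * (prodBernoulli w).real (openConn a b ∩ (openConn a t)ᶜ ∩ openConn t c) ≤
      (prodBernoulli w).real (openConn a b) - (prodBernoulli w).real (openConn c b))
    (hγ : γ * (prodBernoulli w).real (openConn t b ∩ (openConn a t)ᶜ ∩ openConn a c) ≤
      (prodBernoulli w).real (openConn t b) - (prodBernoulli w).real (openConn c b))
    (hX : (prodBernoulli w).real (openConn c b ∩ (openConn a b)ᶜ ∩ (openConn t b)ᶜ) ≤
      (prodBernoulli w).real (openConn a b ∩ openConn t b ∩ (openConn c b)ᶜ) +
        β * (prodBernoulli w).real (openConn a b ∩ (openConn a t)ᶜ ∩ avoidSet ({a, t} : Set V) {c}) +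
        γ * (prodBernoulli w).real (openConn t b ∩ (openConn a t)ᶜ ∩ avoidSet ({a, t} : Set V) {c})) :
    KNGood w ({c, a, t} : Finset V) (Finset.insert_nonempty c {a, t}) o b := by
  have h := strongGood_triple_borrow w o b c a t hca hct β γ hβ0 hγ0 hβγ hβ hγ hX
  have hmono : (prodBernoulli w).real (openConn o b ∩ (openConn o c ∪ openConn o a ∪ openConn o t)) ≤
      (prodBernoulli w).real (openConn o b) := measureReal_mono inter_subset_left
  unfold KNGood
  linarith

/-- **COROLLARY (margin form, competitor `a`).**  With `c` the least reliable relay: if the margin of the weaker competitor covers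
the world `ab|tc`, `P(a↔b) − P(c↔b) ≥ P(a↔b, a↮t, t↔c)`, then `(G, {c,a,t}, o, b)` is good — EVERY finite weighted graph, every
observer (Theorem C with `β = 1`, `γ = 0`).  [cite: KozmaNitzan2024, §3.2 Definition (p. 12), Thm. 2 (p. 8)] -/
theorem knGood_triple_of_margin_a (w : Sym2 V → unitInterval) (o b c a t : V)
    (hca : (prodBernoulli w).real (openConn c b) ≤ (prodBernoulli w).real (openConn a b))
    (hct : (prodBernoulli w).real (openConn c b) ≤ (prodBernoulli w).real (openConn t b))
    (hΔ : (prodBernoulli w).real (openConn a b ∩ (openConn a t)ᶜ ∩ openConn t c) ≤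
      (prodBernoulli w).real (openConn a b) - (prodBernoulli w).real (openConn c b)) :
    KNGood w ({c, a, t} : Finset V) (Finset.insert_nonempty c {a, t}) o b := by
  classical
  refine knGood_triple_borrow w o b c a t hca hct 1 0 zero_le_one le_rfl (by norm_num) (by rw [one_mul]; exact hΔ)
    (by rw [zero_mul]; linarith [hct]) ?_
  -- `m_c ≤ m_{at} + P(W3)`: from the world splits of `P(a↔b)` and `P(c↔b)`
  have Ma := real_cb_split_a w a t c b
  have Mb := real_ab_split w a t c b
  have Sa := real_ab_Da_split w a t c b
  rw [mc_set_eq w a t c b, mK_set_eq w a t c b, one_mul, zero_mul, add_zero]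
  have h9 : 0 ≤ (prodBernoulli w).real ((openConn t c ∩ openConn t b) ∩ avoidSet ({a} : Set V) {t, c}) := measureReal_nonneg
  linarith

/-- **COROLLARY (margin form, competitor `t`).**  If `P(t↔b) − P(c↔b) ≥ P(t↔b, a↮t, a↔c)` then `(G, {c,a,t}, o, b)` is good
(Theorem C with `β = 0`, `γ = 1`).  [cite: KozmaNitzan2024, §3.2 Definition (p. 12), Thm. 2 (p. 8)] -/
theorem knGood_triple_of_margin_t (w : Sym2 V → unitInterval) (o b c a t : V)
    (hca : (prodBernoulli w).real (openConn c b) ≤ (prodBernoulli w).real (openConn a b))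
    (hct : (prodBernoulli w).real (openConn c b) ≤ (prodBernoulli w).real (openConn t b))
    (hΔ : (prodBernoulli w).real (openConn t b ∩ (openConn a t)ᶜ ∩ openConn a c) ≤
      (prodBernoulli w).real (openConn t b) - (prodBernoulli w).real (openConn c b)) :
    KNGood w ({c, a, t} : Finset V) (Finset.insert_nonempty c {a, t}) o b := by
  classical
  refine knGood_triple_borrow w o b c a t hca hct 0 1 le_rfl zero_le_one (by norm_num) (by rw [zero_mul]; linarith [hca])
    (by rw [one_mul]; exact hΔ) ?_
  have Mc := real_cb_split_t w a t c b
  have Md := real_tb_split w a t c b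
  have St := real_tb_Dt_split w a t c b
  rw [mc_set_eq w a t c b, mK_set_eq w a t c b, one_mul, zero_mul, add_zero]
  have h8 : 0 ≤ (prodBernoulli w).real ((openConn a c ∩ openConn a b) ∩ avoidSet ({t} : Set V) {a, c}) := measureReal_nonneg
  linarith

end KNGoodThreeKN

end Summit.CriticalPhenomena.PercolationContinuityZ3.Theorems
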